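import Literature.NumberTheory.Transcendental.KZDirichletPeeling
import Literature.NumberTheory.Transcendental.KZBallVolume
import Literature.NumberTheory.Transcendental.KZGaussMultiplicationChain
import Literature.NumberTheory.Transcendental.KZRulesAssociator
import Summits.KontsevichZagierPeriods.KontsevichZagierPeriods.Theorems.HyperbolicBlochOffTetraSectorKernelStubLindemannRing

/-!
# `VolumeFormOffPlane` (stmt-KontsevichZagierPeriods-14935) — line `Sketch`,
stub `stub_simplexCell` (the open corner simplex is a K-cell: `[Δ_d, 1] ≡ [pt, 1/d!]`)

Write `Δ_m = {u ∈ ℝ^m | u_i > 0, Σ u_i < 1}` and, for natural `k`, `D_m(1; k+1)` for a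
representation PINNED as `[Δ_m, (∏ u_i^{1-1}) (1 - Σ u_i)^{(k+1)-1}]` (Dirichlet's integral at
`s = 1`, value `k!/(m+k)!`), `[pt, v] = KZ.IntegralRep.unit.constMul v _` (a real algebraic constant
over the point `ℝ⁰`). In the formal period ring `P = FormalRep ⧸ relations` we prove, by induction
on `m`, `⟦D_m(1; k+1)⟧ = ⟦[pt, v]⟧` whenever `v · (m+k)! = k!` (`sxc_dirichletOne_toFormalPeriod`):

* `m = 0`: `Δ_0 = ℝ⁰` and the integrand is `1 = v` there (rule (1b), zero difference);
* `m + 1`: Dirichlet peeling `D_{m+1}(1; k+1) ∼ D_m(1; k+2) × β(1, k+1)`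
  (`KZ.dirichletPeel_equivalent`, one change of variables; the auxiliary representations exist by
  `KZ.exists_dirichletRep`, `KZ.exists_betaRep'`), the induction hypothesis at `v (k+1)`,
  `β(1, k+1) ∼ [pt, 1/(k+1)]` (`KZ.BallPeeling.betaOne_equivalent_unit_constMul`, one
  Newton–Leibniz move) and `⟦[pt, a]⟧ ⟦[pt, b]⟧ = ⟦[pt, a b]⟧` (`lindemann_pt_mul`, from
  `KZ.toFormalPeriod_of_constMul`).

At `k = 0` the integrand-`1` representation on `Δ_d` IS `D_d(1; 1)` (both exponents vanish), and
`v = 1/d!`; `KZ.toFormalPeriod_eq_iff` turns the identity of classes into the certificate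
`[Δ_d, 1] − [pt, 1/d!] ∈ relations`.

Sources: Andrews–Askey–Roy 1999, Thm 1.8.1 (Dirichlet's integral); Kontsevich–Zagier 2001, §1.2,
§4.1.
-/

noncomputable section

open MeasureTheory Set
open Literature.NumberTheory.Transcendental
open Summit.KontsevichZagierPeriods.HyperbolicBloch.OffTetraSectorKernel (lindemann_pt_mul
  lindemann_pt_congr)

namespace Summit.KontsevichZagierPeriods.SymplecticScissors.LogPolytope

/-! ## Dirichlet's integral at `s = 1` inside the rules -/

/-- **`⟦D_m(1; k+1)⟧ = ⟦[pt, k!/(m+k)!]⟧`.** For a representation `D` pinned as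
`[Δ_m, (∏ u_i^{1-1}) (1 - Σ u_i)^{(k+1)-1}]` and a real algebraic `v` with `v · (m+k)! = k!`, the
classes of `D` and `[pt, v]` agree in the formal period ring: induction on `m` along Dirichlet
peeling `D_{m+1}(1; k+1) ∼ D_m(1; k+2) × β(1, k+1)` (`KZ.dirichletPeel_equivalent`), with
`β(1, k+1) ∼ [pt, 1/(k+1)]` (`KZ.BallPeeling.betaOne_equivalent_unit_constMul`) and
`⟦[pt, a]⟧ ⟦[pt, b]⟧ = ⟦[pt, a b]⟧`; at `m = 0` both representations live on `ℝ⁰` with integrand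
`1 = v`. Value identity `Γ(1)^m Γ(k+1)/Γ(m+k+1) = k!/(m+k)!`.
[Andrews–Askey–Roy 1999, Thm 1.8.1; Kontsevich–Zagier 2001, §1.2] [folklore] -/
theorem sxc_dirichletOne_toFormalPeriod : ∀ (m k : ℕ) (D : KZ.IntegralRep m),
    D.domain = {u | (∀ i, 0 < u i) ∧ ∑ i, u i < 1} →
    Set.EqOn D.integrand (fun u => (∏ i, (u i) ^ (((1:ℚ):ℝ) - 1)) *
      (1 - ∑ i, u i) ^ ((((k:ℚ) + 1 : ℚ):ℝ) - 1)) D.domain →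
    ∀ (v : ℝ) (hv : IsAlgebraic ℚ v), v * (Nat.factorial (m + k) : ℝ) = Nat.factorial k →
    KZ.toFormalPeriod (KZ.of D) =
      KZ.toFormalPeriod (KZ.of (KZ.IntegralRep.unit.constMul v hv))
  | 0, k, D, hDd, hDi, v, hv, hval => by
    have hk : (Nat.factorial k : ℝ) ≠ 0 := Nat.cast_ne_zero.mpr (Nat.factorial_ne_zero k)
    have hv1 : v = 1 := by
      rw [Nat.zero_add] at hval
      refine mul_right_cancel₀ hk ?_
      rw [one_mul]
      exact hval
    refine KZ.toFormalPeriod_eq_iff.mpr (KZ.of_sub_of_mem_relations_of_eqOn ?_ fun u hu => ?_)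
    · rw [KZ.IntegralRep.domain_constMul, KZ.IntegralRep.unit_domain, hDd]
      ext u
      simp
    · rw [hDi hu]
      simp [hv1]
  | m + 1, k, D, hDd, hDi, v, hv, hval => by
    have hk1 : (0 : ℚ) < (k : ℚ) + 1 := by positivity
    -- the auxiliary representations `D' = D_m(1; k+2)` and `B = β(1, k+1)`
    obtain ⟨D', hD'd, hD'i⟩ := KZ.exists_dirichletRep 1 one_pos m ((k : ℚ) + 1 + 1) (by positivity)
    obtain ⟨B, hBd, hBi⟩ := KZ.exists_betaRep' 1 ((k : ℚ) + 1) one_pos hk1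
    -- peeling: `D ∼ D' × B`
    have hpeel : KZ.Equivalent D (D'.prod B) :=
      KZ.dirichletPeel_equivalent 1 ((k : ℚ) + 1) D D' B hDd hDi hD'd (fun u _ => by rw [hD'i]) hBd
        (fun t _ => by rw [hBi])
    -- the induction hypothesis at `v (k+1)`
    have hvk : IsAlgebraic ℚ (v * ((k : ℝ) + 1)) := by
      have h1 : IsAlgebraic ℚ ((k : ℝ) + 1) := by exact_mod_cast isAlgebraic_nat (k + 1)
      exact hv.mul h1
    have hD' : KZ.toFormalPeriod (KZ.of D') =
        KZ.toFormalPeriod (KZ.of (KZ.IntegralRep.unit.constMul (v * ((k : ℝ) + 1)) hvk)) := by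
      refine sxc_dirichletOne_toFormalPeriod m (k + 1) D' hD'd (fun u _ => ?_) _ hvk ?_
      · rw [hD'i]
        push_cast
        ring_nf
      · rw [show m + (k + 1) = m + 1 + k from by omega, Nat.factorial_succ]
        push_cast
        rw [← hval]
        ring
    -- `B ∼ [pt, 1/(k+1)]`
    have hq : IsAlgebraic ℚ (((k : ℝ) + 1)⁻¹) := by exact_mod_cast (isAlgebraic_nat (k + 1)).inv
    have hB : KZ.toFormalPeriod (KZ.of B) =
        KZ.toFormalPeriod (KZ.of (KZ.IntegralRep.unit.constMul (((k : ℝ) + 1)⁻¹) hq)) :=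
      (KZ.BallPeeling.betaOne_equivalent_unit_constMul k B hBd (fun t _ => by rw [hBi])
        hq).toFormalPeriod_eq
    have hk0 : (k : ℝ) + 1 ≠ 0 := by positivity
    rw [hpeel.toFormalPeriod_eq, ← KZ.toFormalPeriod_of_mul_of, hD', hB, ← lindemann_pt_mul]
    exact lindemann_pt_congr _ _ (by field_simp)

/-! ## The stub -/

/-- **Stub (v7-5, THE SIMPLEX IS A K-CELL: `[Δ_d, 1] ≡ [pt, 1/d!]`).** The integrand-`1`
representation on the open corner simplex `Δ_d = {x > 0, ∑ xᵢ < 1}` differs by relations from the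
point `[pt, 1/d!]`: Dirichlet peeling `D_{m+1}(1; c) ∼ D_m(1; c+1) × β(1, c)`
(`KZ.dirichletPeel_equivalent`, one rule-(2) move each), `β(1, c) ∼ [pt, 1/c]`
(`KZ.BallPeeling.betaOne_equivalent_unit_constMul`), products of points are points, and
`D_0 = [pt, 1]` (`sxc_dirichletOne_toFormalPeriod` at `k = 0`, where the integrand `1` on `Δ_d` IS
Dirichlet's `(∏ xᵢ^0)(1 - ∑ xᵢ)^0`).
[Andrews–Askey–Roy 1999, Thm 1.8.1; Kontsevich–Zagier 2001, §1.2] [folklore] -/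
theorem stub_simplexCell : ∀ (d : ℕ) (ρ : KZ.IntegralRep d),
    ρ.domain = {x : Fin d → ℝ | (∀ i, 0 < x i) ∧ ∑ i, x i < 1} →
    (∀ x ∈ ρ.domain, ρ.integrand x = 1) →
    ∀ hv : IsAlgebraic ℚ ((Nat.factorial d : ℝ)⁻¹),
      KZ.of ρ - KZ.of (KZ.IntegralRep.unit.constMul ((Nat.factorial d : ℝ)⁻¹) hv) ∈
        KZ.relations := by
  intro d ρ hρd hρi hv
  refine KZ.toFormalPeriod_eq_iff.mp
    (sxc_dirichletOne_toFormalPeriod d 0 ρ hρd (fun x hx => ?_) _ hv ?_)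
  · rw [hρi x hx]
    simp
  · rw [Nat.add_zero, inv_mul_cancel₀ (Nat.cast_ne_zero.mpr (Nat.factorial_ne_zero d)),
      Nat.factorial_zero, Nat.cast_one]

end Summit.KontsevichZagierPeriods.SymplecticScissors.LogPolytope

end
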